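import Literature.NumberTheory.EllipticCurves.TorsionPointHauptmodul
import Literature.NumberTheory.EllipticCurves.Isogeny
import HarnessLib

/-!
# Klein–Fricke at level 9: a Galois-stable cyclic subgroup of order `9` gives a point of `X₀(9)`

For an elliptic curve `W` over a field `F`, a Galois extension `L/F` and a point `P ∈ W(L)` of
order `9` whose cyclic subgroup `⟨P⟩` is `Gal(L/F)`-stable (`σP ∈ ℤP` for all `σ`), there is
`η ∈ F` with `η(η² + 9η + 27) ≠ 0` and

  `j(W) · η(η² + 9η + 27) = (η + 3)³ (η³ + 9η² + 27η + 3)³`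

(`exists_hauptmodul_nine_of_torsion`), i.e. `W` gives an `F`-rational point of the genus-`0` curve
`X₀(9)`, in the normalisation of Maier's canonical Hauptmodul `t₉ = 3³([9]/[1])³`
(R. S. Maier, *On rationally parametrized modular equations*, J. Ramanujan Math. Soc. **24** (2009)
1–73 = arXiv:math/0611041, Table 4 (level `9`) and eq. (gammaformula), p. 13:
`j = (t₉+3)³(t₉³+9t₉²+27t₉+3)³/(t₉(t₉²+9t₉+27))`). In particular (`CharZero`, `L = K̄`) an
elliptic curve with a `K`-rational **cyclic** isogeny of degree `9` has such an `η ∈ K`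
(`Isogeny.exists_hauptmodul_nine_of_isCyclic`) — the classical input "a rational cyclic
`9`-isogeny is a rational point of `X₀(9)`" of Kenku's treatment of the levels `27`, `45`, `63`,
`81`, here proved from first principles (no modular curves).

## Method (Tate normal form, as in `TorsionPointNormalForms` / `TorsionPointHauptmodul`)

Move `P` to `(0,0)` with horizontal tangent: `W ≅ [A₁, A₂, A₃, 0, 0]` with
`A₁ = a₁ + 2λ_P`, `A₂ = a₂ - λ_P a₁ + 3x_P - λ_P²`, `A₃ = y_P - ȳ_P` (`tgA₁`, `tgA₂`, `tgA₃`). The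
Tate–Kubert coordinates of `(W, P)` are `b = -A₂³/A₃²`, `c = 1 - A₁A₂/A₃` (`W ≅ E(b, c)`), and on
`X₁(9)` one has Kubert's parametrisation `c = f²(f-1)`, `b = f²(f-1)(f²-f+1)` (Kubert,
*Universal bounds on the torsion of elliptic curves*, Proc. LMS 33 (1976), Table 3) with
`f = c²/(b - c) = -(A₃ - A₁A₂)²/(A₂³ - A₁A₂A₃ + A₃²)` (`tateNine`); the order-`9` condition is the
single relation `R³ + A₃ C³ (C² + R) = 0`, `C = A₃ - A₁A₂`, `R = A₂³ - A₁A₂A₃ + A₃²`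
(`tate_relation_of_order_nine`, from `2·(3P) = -(3P)` by the chord-and-tangent formulae). Then
`Δ = u¹² f⁹(f-1)⁹(f²-f+1)³(f³-6f²+3f+1)`, `c₄ = u⁴(f³-3f²+1)(f⁹-9f⁸+27f⁷-48f⁶+54f⁵-45f⁴+27f³-9f²+1)`
(`j_mul_tateNine_of_order_nine`), the deck transformation `P ↦ 2P` of `X₁(9) → X₀(9)` acts by
`f(2P) = (f(P) - 1)/f(P)` (order `3` modulo `±1`; `tateNine_of_order_nine`), `f(-P) = f(P)`,
`σ f(P) = f(σP)`, so `η = (f³ - 6f² + 3f + 1)/(f(f-1)) = f + f' + f'' - 6` (sum over the deck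
orbit) is `Gal(L/F)`-invariant and descends (`InfiniteGalois.mem_range_algebraMap_iff_fixed`).
All identities are checked by `ring`/`linear_combination`; the closed forms were found with a
computer algebra system (compute jobs `j027337`, `j027383`) but nothing below depends on that
computation. [cite: Maier2006, Table 4 (N = 9) and eq. (gammaformula); Kubert1976, Table 3]
-/

noncomputable section

open scoped Classical

namespace WeierstrassCurve

universe u

variable {F : Type u} [Field F] (W : WeierstrassCurve F) {L : Type u} [Field L] [Algebra F L]

/-! ### §1. The tangent-normalised coefficients and the Tate–Kubert parameter `f` -/

section Defs

/-- `A₁(P) = a₁ + 2λ_P`: the `a₁` of the normal form `[A₁, A₂, A₃, 0, 0]` of `W` at the affine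
point `P = (x, y)` (`λ_P` the tangent slope). [cite: SilvermanAEC2009, III.1 Table 3.1] -/
def tgA₁ (x y : F) : F :=
  W.a₁ + 2 * W.toAffine.slope x x y y

/-- `A₂(P) = a₂ - λ_P a₁ + 3x - λ_P²`. [cite: SilvermanAEC2009, III.1 Table 3.1] -/
def tgA₂ (x y : F) : F :=
  W.a₂ - W.toAffine.slope x x y y * W.a₁ + 3 * x - W.toAffine.slope x x y y ^ 2

/-- `A₃(P) = y - ȳ`. [cite: SilvermanAEC2009, III.1 Table 3.1] -/
def tgA₃ (x y : F) : F :=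
  y - W.toAffine.negY x y

/-- The Tate–Kubert parameter `f(P) = c²/(b - c) = -(A₃ - A₁A₂)²/(A₂³ - A₁A₂A₃ + A₃²)` of the
pair `(W, P)` (`b = -A₂³/A₃²`, `c = 1 - A₁A₂/A₃`); for `P` of order `9` it is Kubert's coordinate on
`X₁(9)` (`c = f²(f-1)`, `b = f²(f-1)(f²-f+1)`). [cite: Kubert1976, Table 3 (N = 9)] -/
def tateNine (x y : F) : F :=
  -(W.tgA₃ x y - W.tgA₁ x y * W.tgA₂ x y) ^ 2 /
    (W.tgA₂ x y ^ 3 - W.tgA₁ x y * W.tgA₂ x y * W.tgA₃ x y + W.tgA₃ x y ^ 2)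

end Defs

variable {W}

/-! ### §2. `f` at the origin of a normal form, under negation, under `u = 1` changes, under Galois -/

section Basic

/-- On `[a₁, a₂, a₃, 0, 0]` (`a₃ ≠ 0`) the tangent at `(0,0)` is horizontal: `A₁(0,0) = a₁`.
[folklore] -/
theorem tgA₁_origin (h4 : W.a₄ = 0) (h3 : W.a₃ ≠ 0) : W.tgA₁ 0 0 = W.a₁ := by
  have hy : (0 : F) ≠ W.toAffine.negY 0 0 := by
    simp only [Affine.negY, mul_zero, sub_zero, neg_zero, zero_sub, ne_eq, zero_eq_neg]
    exact h3
  rw [tgA₁, Affine.slope_of_Y_ne rfl hy]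
  simp [h4]

/-- `A₂(0,0) = a₂` on `[a₁, a₂, a₃, 0, 0]`. [folklore] -/
theorem tgA₂_origin (h4 : W.a₄ = 0) (h3 : W.a₃ ≠ 0) : W.tgA₂ 0 0 = W.a₂ := by
  have hy : (0 : F) ≠ W.toAffine.negY 0 0 := by
    simp only [Affine.negY, mul_zero, sub_zero, neg_zero, zero_sub, ne_eq, zero_eq_neg]
    exact h3
  rw [tgA₂, Affine.slope_of_Y_ne rfl hy]
  simp [h4]

/-- `A₃(0,0) = a₃`. [folklore] -/
theorem tgA₃_origin : W.tgA₃ 0 0 = W.a₃ := by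
  simp [tgA₃, Affine.negY]

/-- `f(0,0) = -(a₃ - a₁a₂)²/(a₂³ - a₁a₂a₃ + a₃²)` on `[a₁, a₂, a₃, 0, 0]`. [folklore] -/
theorem tateNine_origin (h4 : W.a₄ = 0) (h3 : W.a₃ ≠ 0) :
    W.tateNine 0 0 =
      -(W.a₃ - W.a₁ * W.a₂) ^ 2 / (W.a₂ ^ 3 - W.a₁ * W.a₂ * W.a₃ + W.a₃ ^ 2) := by
  rw [tateNine, tgA₁_origin h4 h3, tgA₂_origin h4 h3, tgA₃_origin]

/-- `A₁(-P) = -A₁(P)` (`λ ↦ -λ - a₁`). [folklore] -/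
theorem tgA₁_negY {x y : F} (hy : y ≠ W.toAffine.negY x y) :
    W.tgA₁ x (W.toAffine.negY x y) = -W.tgA₁ x y := by
  rw [tgA₁, tgA₁, slope_negY_negY hy]
  ring

/-- `A₂(-P) = A₂(P)`. [folklore] -/
theorem tgA₂_negY {x y : F} (hy : y ≠ W.toAffine.negY x y) :
    W.tgA₂ x (W.toAffine.negY x y) = W.tgA₂ x y := by
  rw [tgA₂, tgA₂, slope_negY_negY hy]
  ring

/-- `A₃(-P) = -A₃(P)`. [folklore] -/
theorem tgA₃_negY (x y : F) : W.tgA₃ x (W.toAffine.negY x y) = -W.tgA₃ x y := by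
  rw [tgA₃, tgA₃, Affine.negY_negY]
  ring

/-- `f(-P) = f(P)`. [folklore] -/
theorem tateNine_negY {x y : F} (hy : y ≠ W.toAffine.negY x y) :
    W.tateNine x (W.toAffine.negY x y) = W.tateNine x y := by
  rw [tateNine, tateNine, tgA₁_negY hy, tgA₂_negY hy, tgA₃_negY]
  ring

/-- `A₁` is unchanged by a change of variables with `u = 1`. [folklore] -/
theorem tgA₁_toXY (C : VariableChange F) (hu : C.u = 1) {x y : F} (h : W.toAffine.Equation x y)
    (hy : y ≠ W.toAffine.negY x y) :
    (C • W).tgA₁ (C.toX x) (C.toY x y) = W.tgA₁ x y := by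
  rw [tgA₁, tgA₁, VariableChange.slope_toXY W C h h (fun hh => hy hh.2)]
  simp only [variableChange_a₁, hu, inv_one, Units.val_one, one_mul]
  ring

/-- `A₂` is unchanged by a change of variables with `u = 1`. [folklore] -/
theorem tgA₂_toXY (C : VariableChange F) (hu : C.u = 1) {x y : F} (h : W.toAffine.Equation x y)
    (hy : y ≠ W.toAffine.negY x y) :
    (C • W).tgA₂ (C.toX x) (C.toY x y) = W.tgA₂ x y := by
  rw [tgA₂, tgA₂, VariableChange.slope_toXY W C h h (fun hh => hy hh.2)]
  simp only [VariableChange.toX, variableChange_a₁, variableChange_a₂, hu, inv_one, Units.val_one,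
    one_pow, one_mul]
  ring

/-- `A₃ = y - ȳ` is unchanged by a change of variables with `u = 1`. [folklore] -/
theorem tgA₃_toXY (C : VariableChange F) (hu : C.u = 1) (x y : F) :
    (C • W).tgA₃ (C.toX x) (C.toY x y) = W.tgA₃ x y := by
  rw [tgA₃, tgA₃, VariableChange.negY_toXY]
  simp only [VariableChange.toY, hu, inv_one, Units.val_one, one_pow, one_mul]
  ring

/-- `f` is unchanged by a change of variables with `u = 1`. [folklore] -/
theorem tateNine_toXY (C : VariableChange F) (hu : C.u = 1) {x y : F}
    (h : W.toAffine.Equation x y) (hy : y ≠ W.toAffine.negY x y) :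
    (C • W).tateNine (C.toX x) (C.toY x y) = W.tateNine x y := by
  rw [tateNine, tateNine, tgA₁_toXY C hu h hy, tgA₂_toXY C hu h hy, tgA₃_toXY C hu]

/-- `f` is Galois-equivariant: `σ(f(x, y)) = f(σx, σy)` on `W_L` (`W` defined over `F`). [folklore] -/
theorem map_tateNine (σ : L →ₐ[F] L) (x y : L) :
    σ ((W.baseChange L).tateNine x y) = (W.baseChange L).tateNine (σ x) (σ y) := by
  have ha₁ : σ (W.baseChange L).a₁ = (W.baseChange L).a₁ := σ.commutes W.a₁
  have ha₂ : σ (W.baseChange L).a₂ = (W.baseChange L).a₂ := σ.commutes W.a₂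
  simp only [tateNine, tgA₁, tgA₂, tgA₃, map_div₀, map_neg, map_pow, map_sub, map_add, map_mul,
    map_ofNat, ha₁, ha₂, Affine.baseChange_slope, Affine.baseChange_negY]

end Basic

/-! ### §3. The order-`9` relation on `[a₁, a₂, a₃, 0, 0]` and Kubert's parametrisation -/

section Family

/-- `3·(0,0)` on `[a₁, a₂, a₃, 0, 0]` (`a₂a₃ ≠ 0`): `(0,0) + (-a₂, a₁a₂ - a₃) =
(a₃(a₃ - a₁a₂)/a₂², -a₃(a₂³ - a₁a₂a₃ + a₃²)/a₂³)` (chord through `P₀` and `2P₀`; on `E(b,c)` this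
is the point `(c, b - c)`). [folklore] -/
theorem three_smul_zero_zero (h4 : W.a₄ = 0) (h6 : W.a₆ = 0) (h3 : W.a₃ ≠ 0) (h2 : W.a₂ ≠ 0) :
    ∃ hT, (Affine.Point.some _ _ (nonsingular_origin_of_a₃_ne_zero h6 h3) : W.toAffine.Point) +
        ((Affine.Point.some _ _ (nonsingular_origin_of_a₃_ne_zero h6 h3) : W.toAffine.Point) +
          Affine.Point.some _ _ (nonsingular_origin_of_a₃_ne_zero h6 h3)) =
      Affine.Point.some (W.a₃ * (W.a₃ - W.a₁ * W.a₂) / W.a₂ ^ 2)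
        (-(W.a₃ * (W.a₂ ^ 3 - W.a₁ * W.a₂ * W.a₃ + W.a₃ ^ 2)) / W.a₂ ^ 3) hT := by
  obtain ⟨hQ, h2P⟩ := two_smul_zero_zero h4 h6 h3
  rw [h2P]
  have hx : (0 : F) ≠ -W.a₂ := fun h => h2 (neg_eq_zero.1 h.symm)
  have hs : W.toAffine.slope 0 (-W.a₂) 0 (W.a₁ * W.a₂ - W.a₃) = (W.a₃ - W.a₁ * W.a₂) / W.a₂ := by
    rw [Affine.slope_of_X_ne hx]
    field_simp
    ring
  have hX : W.toAffine.addX 0 (-W.a₂) (W.toAffine.slope 0 (-W.a₂) 0 (W.a₁ * W.a₂ - W.a₃)) =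
      W.a₃ * (W.a₃ - W.a₁ * W.a₂) / W.a₂ ^ 2 := by
    rw [hs]
    simp only [Affine.addX]
    field_simp
    ring
  have hY : W.toAffine.addY 0 (-W.a₂) 0 (W.toAffine.slope 0 (-W.a₂) 0 (W.a₁ * W.a₂ - W.a₃)) =
      -(W.a₃ * (W.a₂ ^ 3 - W.a₁ * W.a₂ * W.a₃ + W.a₃ ^ 2)) / W.a₂ ^ 3 := by
    rw [Affine.addY, Affine.negAddY, hX, hs]
    simp only [Affine.negY]
    field_simp
    ring
  refine ⟨?_, ?_⟩
  · have := Affine.nonsingular_add (nonsingular_origin_of_a₃_ne_zero h6 h3) hQ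
      (fun hxy => hx hxy.1)
    rwa [hX, hY] at this
  · rw [Affine.Point.add_of_X_ne hx]
    exact (Affine.Point.some.injEq _ _ _ _ _ _).mpr ⟨hX, hY⟩

/-- **Order `9` criterion.** On `[a₁, a₂, a₃, 0, 0]` (`a₃ ≠ 0`), put `P₀ = (0,0)` and `T = 3P₀`.
If `2P₀ ≠ -P₀`, `2T ≠ O` and `2T = -T` (so `P₀` has order `9`) then `a₂ ≠ 0` and, with
`C = a₃ - a₁a₂`, `R = a₂³ - a₁a₂a₃ + a₃²`, the **`X₁(9)` relation** `R³ + a₃C³(C² + R) = 0` holds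
(in Tate's coordinates `b = -a₂³/a₃²`, `c = C/a₃`: `(b - c)³ = c³(c² + c - b)`, Kubert's
`X₁(9)`). Proof: `x(2T) = x(T)` cleared of denominators is `a₂⁻⁸ a₃² (R³ + a₃C³(C² + R)) = 0`.
[folklore] -/
theorem tate_relation_of_order_nine (h4 : W.a₄ = 0) (h6 : W.a₆ = 0) (h3 : W.a₃ ≠ 0)
    (hne : (Affine.Point.some _ _ (nonsingular_origin_of_a₃_ne_zero h6 h3) : W.toAffine.Point) +
        Affine.Point.some _ _ (nonsingular_origin_of_a₃_ne_zero h6 h3) ≠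
        -Affine.Point.some _ _ (nonsingular_origin_of_a₃_ne_zero h6 h3))
    (h6ne : ((Affine.Point.some _ _ (nonsingular_origin_of_a₃_ne_zero h6 h3) : W.toAffine.Point) +
        ((Affine.Point.some _ _ (nonsingular_origin_of_a₃_ne_zero h6 h3) : W.toAffine.Point) +
          Affine.Point.some _ _ (nonsingular_origin_of_a₃_ne_zero h6 h3))) +
        ((Affine.Point.some _ _ (nonsingular_origin_of_a₃_ne_zero h6 h3) : W.toAffine.Point) +
        ((Affine.Point.some _ _ (nonsingular_origin_of_a₃_ne_zero h6 h3) : W.toAffine.Point) +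
          Affine.Point.some _ _ (nonsingular_origin_of_a₃_ne_zero h6 h3))) ≠ 0)
    (h9 : ((Affine.Point.some _ _ (nonsingular_origin_of_a₃_ne_zero h6 h3) : W.toAffine.Point) +
        ((Affine.Point.some _ _ (nonsingular_origin_of_a₃_ne_zero h6 h3) : W.toAffine.Point) +
          Affine.Point.some _ _ (nonsingular_origin_of_a₃_ne_zero h6 h3))) +
        ((Affine.Point.some _ _ (nonsingular_origin_of_a₃_ne_zero h6 h3) : W.toAffine.Point) +
        ((Affine.Point.some _ _ (nonsingular_origin_of_a₃_ne_zero h6 h3) : W.toAffine.Point) +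
          Affine.Point.some _ _ (nonsingular_origin_of_a₃_ne_zero h6 h3))) =
        -((Affine.Point.some _ _ (nonsingular_origin_of_a₃_ne_zero h6 h3) : W.toAffine.Point) +
        ((Affine.Point.some _ _ (nonsingular_origin_of_a₃_ne_zero h6 h3) : W.toAffine.Point) +
          Affine.Point.some _ _ (nonsingular_origin_of_a₃_ne_zero h6 h3)))) :
    W.a₂ ≠ 0 ∧
      (W.a₂ ^ 3 - W.a₁ * W.a₂ * W.a₃ + W.a₃ ^ 2) ^ 3 +
          W.a₃ * (W.a₃ - W.a₁ * W.a₂) ^ 3 *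
            ((W.a₃ - W.a₁ * W.a₂) ^ 2 + (W.a₂ ^ 3 - W.a₁ * W.a₂ * W.a₃ + W.a₃ ^ 2)) = 0 := by
  obtain ⟨hQ, h2P⟩ := two_smul_zero_zero h4 h6 h3
  -- `a₂ ≠ 0`: otherwise `2P₀ = (0, -a₃) = -P₀`
  have h2 : W.a₂ ≠ 0 := by
    intro ha
    apply hne
    rw [h2P, Affine.Point.neg_some]
    congr 1
    · rw [ha, neg_zero]
    · simp [Affine.negY, ha]
  refine ⟨h2, ?_⟩
  obtain ⟨hT, h3P⟩ := three_smul_zero_zero h4 h6 h3 h2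
  rw [h3P] at h6ne h9
  generalize hxT : W.a₃ * (W.a₃ - W.a₁ * W.a₂) / W.a₂ ^ 2 = xT at hT h6ne h9
  generalize hyT : -(W.a₃ * (W.a₂ ^ 3 - W.a₁ * W.a₂ * W.a₃ + W.a₃ ^ 2)) / W.a₂ ^ 3 = yT at hT h6ne h9
  -- `T ≠ -T` (else `2T = O`)
  have hy : yT ≠ W.toAffine.negY xT yT := fun h => h6ne (Affine.Point.add_self_of_Y_eq h)
  rw [Affine.Point.add_self_of_Y_ne hy, Affine.Point.neg_some] at h9
  have hx := ((Affine.Point.some.injEq _ _ _ _ _ _).mp h9).1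
  simp only [Affine.addX] at hx
  -- `λ_T (y_T - ȳ_T) = 3x_T² + 2a₂x_T - a₁y_T`
  have hE : yT - W.toAffine.negY xT yT ≠ 0 := sub_ne_zero.2 hy
  have hL : W.toAffine.slope xT xT yT yT * (yT - W.toAffine.negY xT yT) =
      3 * xT ^ 2 + 2 * W.a₂ * xT - W.a₁ * yT := by
    rw [Affine.slope_of_Y_ne rfl hy, div_mul_cancel₀ _ hE, h4, add_zero]
  generalize W.toAffine.slope xT xT yT yT = Λ at hx hL
  -- clear the denominator `(y_T - ȳ_T)²` in `x(2T) = x(T)`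
  have key : (3 * xT ^ 2 + 2 * W.a₂ * xT - W.a₁ * yT) ^ 2 +
      W.a₁ * (3 * xT ^ 2 + 2 * W.a₂ * xT - W.a₁ * yT) * (yT - W.toAffine.negY xT yT) -
        (W.a₂ + 3 * xT) * (yT - W.toAffine.negY xT yT) ^ 2 = 0 := by
    linear_combination (yT - W.toAffine.negY xT yT) ^ 2 * hx -
      ((3 * xT ^ 2 + 2 * W.a₂ * xT - W.a₁ * yT) + Λ * (yT - W.toAffine.negY xT yT) +
        W.a₁ * (yT - W.toAffine.negY xT yT)) * hL
  -- and substitute the coordinates of `T`: the result is `a₂⁻⁸ · (-a₃²) · (R³ + a₃C³(C² + R))`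
  simp only [Affine.negY] at key
  subst hxT hyT
  have key' : W.a₃ ^ 2 * ((W.a₂ ^ 3 - W.a₁ * W.a₂ * W.a₃ + W.a₃ ^ 2) ^ 3 +
      W.a₃ * (W.a₃ - W.a₁ * W.a₂) ^ 3 *
        ((W.a₃ - W.a₁ * W.a₂) ^ 2 + (W.a₂ ^ 3 - W.a₁ * W.a₂ * W.a₃ + W.a₃ ^ 2))) = 0 := by
    have e : W.a₃ ^ 2 * ((W.a₂ ^ 3 - W.a₁ * W.a₂ * W.a₃ + W.a₃ ^ 2) ^ 3 +
        W.a₃ * (W.a₃ - W.a₁ * W.a₂) ^ 3 *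
          ((W.a₃ - W.a₁ * W.a₂) ^ 2 + (W.a₂ ^ 3 - W.a₁ * W.a₂ * W.a₃ + W.a₃ ^ 2))) =
        -(W.a₂ ^ 8) * ((3 * (W.a₃ * (W.a₃ - W.a₁ * W.a₂) / W.a₂ ^ 2) ^ 2 +
            2 * W.a₂ * (W.a₃ * (W.a₃ - W.a₁ * W.a₂) / W.a₂ ^ 2) -
              W.a₁ * (-(W.a₃ * (W.a₂ ^ 3 - W.a₁ * W.a₂ * W.a₃ + W.a₃ ^ 2)) / W.a₂ ^ 3)) ^ 2 +
          W.a₁ * (3 * (W.a₃ * (W.a₃ - W.a₁ * W.a₂) / W.a₂ ^ 2) ^ 2 +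
              2 * W.a₂ * (W.a₃ * (W.a₃ - W.a₁ * W.a₂) / W.a₂ ^ 2) -
                W.a₁ * (-(W.a₃ * (W.a₂ ^ 3 - W.a₁ * W.a₂ * W.a₃ + W.a₃ ^ 2)) / W.a₂ ^ 3)) *
            (-(W.a₃ * (W.a₂ ^ 3 - W.a₁ * W.a₂ * W.a₃ + W.a₃ ^ 2)) / W.a₂ ^ 3 -
              (-(-(W.a₃ * (W.a₂ ^ 3 - W.a₁ * W.a₂ * W.a₃ + W.a₃ ^ 2)) / W.a₂ ^ 3) -
                W.a₁ * (W.a₃ * (W.a₃ - W.a₁ * W.a₂) / W.a₂ ^ 2) - W.a₃)) -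
          (W.a₂ + 3 * (W.a₃ * (W.a₃ - W.a₁ * W.a₂) / W.a₂ ^ 2)) *
            (-(W.a₃ * (W.a₂ ^ 3 - W.a₁ * W.a₂ * W.a₃ + W.a₃ ^ 2)) / W.a₂ ^ 3 -
              (-(-(W.a₃ * (W.a₂ ^ 3 - W.a₁ * W.a₂ * W.a₃ + W.a₃ ^ 2)) / W.a₂ ^ 3) -
                W.a₁ * (W.a₃ * (W.a₃ - W.a₁ * W.a₂) / W.a₂ ^ 2) - W.a₃)) ^ 2) := by
      field_simp
      ring
    rw [e, key, mul_zero]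
  exact (mul_eq_zero.1 key').resolve_left (pow_ne_zero 2 h3)

/-- **Kubert's parametrisation of `X₁(9)`.** On `[a₁, a₂, a₃, 0, 0]` with `a₂a₃ ≠ 0` and the
`X₁(9)` relation `R³ + a₃C³(C² + R) = 0` (`C = a₃ - a₁a₂`, `R = a₂³ - a₁a₂a₃ + a₃²`): `C ≠ 0`,
`R ≠ 0`, and with `f := -C²/R`, `u := a₃/a₂` one has `f ≠ 0`, `f ≠ 1`, `f² - f + 1 ≠ 0` and
`a₁ = u(1 - f²(f-1))`, `a₂ = -u²f²(f-1)(f²-f+1)`, `a₃ = -u³f²(f-1)(f²-f+1)`, i.e. the curve is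
`E(b, c)` scaled by `u` with `c = f²(f-1)`, `b = f²(f-1)(f²-f+1)`.
[cite: Kubert1976, Table 3 (N = 9)] -/
theorem tate_parametrisation_nine (h2 : W.a₂ ≠ 0) (h3 : W.a₃ ≠ 0)
    (hR : (W.a₂ ^ 3 - W.a₁ * W.a₂ * W.a₃ + W.a₃ ^ 2) ^ 3 +
        W.a₃ * (W.a₃ - W.a₁ * W.a₂) ^ 3 *
          ((W.a₃ - W.a₁ * W.a₂) ^ 2 + (W.a₂ ^ 3 - W.a₁ * W.a₂ * W.a₃ + W.a₃ ^ 2)) = 0) :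
    W.a₃ - W.a₁ * W.a₂ ≠ 0 ∧ W.a₂ ^ 3 - W.a₁ * W.a₂ * W.a₃ + W.a₃ ^ 2 ≠ 0 ∧
      -(W.a₃ - W.a₁ * W.a₂) ^ 2 / (W.a₂ ^ 3 - W.a₁ * W.a₂ * W.a₃ + W.a₃ ^ 2) ≠ 0 ∧
      -(W.a₃ - W.a₁ * W.a₂) ^ 2 / (W.a₂ ^ 3 - W.a₁ * W.a₂ * W.a₃ + W.a₃ ^ 2) - 1 ≠ 0 ∧
      (-(W.a₃ - W.a₁ * W.a₂) ^ 2 / (W.a₂ ^ 3 - W.a₁ * W.a₂ * W.a₃ + W.a₃ ^ 2)) ^ 2 -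
          -(W.a₃ - W.a₁ * W.a₂) ^ 2 / (W.a₂ ^ 3 - W.a₁ * W.a₂ * W.a₃ + W.a₃ ^ 2) + 1 ≠ 0 ∧
      W.a₁ = W.a₃ / W.a₂ *
          (1 - (-(W.a₃ - W.a₁ * W.a₂) ^ 2 / (W.a₂ ^ 3 - W.a₁ * W.a₂ * W.a₃ + W.a₃ ^ 2)) ^ 2 *
            (-(W.a₃ - W.a₁ * W.a₂) ^ 2 / (W.a₂ ^ 3 - W.a₁ * W.a₂ * W.a₃ + W.a₃ ^ 2) - 1)) ∧
      W.a₂ = -(W.a₃ / W.a₂) ^ 2 *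
          ((-(W.a₃ - W.a₁ * W.a₂) ^ 2 / (W.a₂ ^ 3 - W.a₁ * W.a₂ * W.a₃ + W.a₃ ^ 2)) ^ 2 *
            (-(W.a₃ - W.a₁ * W.a₂) ^ 2 / (W.a₂ ^ 3 - W.a₁ * W.a₂ * W.a₃ + W.a₃ ^ 2) - 1) *
            ((-(W.a₃ - W.a₁ * W.a₂) ^ 2 / (W.a₂ ^ 3 - W.a₁ * W.a₂ * W.a₃ + W.a₃ ^ 2)) ^ 2 -
              -(W.a₃ - W.a₁ * W.a₂) ^ 2 / (W.a₂ ^ 3 - W.a₁ * W.a₂ * W.a₃ + W.a₃ ^ 2) + 1)) ∧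
      W.a₃ = -(W.a₃ / W.a₂) ^ 3 *
          ((-(W.a₃ - W.a₁ * W.a₂) ^ 2 / (W.a₂ ^ 3 - W.a₁ * W.a₂ * W.a₃ + W.a₃ ^ 2)) ^ 2 *
            (-(W.a₃ - W.a₁ * W.a₂) ^ 2 / (W.a₂ ^ 3 - W.a₁ * W.a₂ * W.a₃ + W.a₃ ^ 2) - 1) *
            ((-(W.a₃ - W.a₁ * W.a₂) ^ 2 / (W.a₂ ^ 3 - W.a₁ * W.a₂ * W.a₃ + W.a₃ ^ 2)) ^ 2 -
              -(W.a₃ - W.a₁ * W.a₂) ^ 2 / (W.a₂ ^ 3 - W.a₁ * W.a₂ * W.a₃ + W.a₃ ^ 2) + 1)) := by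
  obtain ⟨c, hc⟩ : ∃ c : F, c = W.a₃ - W.a₁ * W.a₂ := ⟨_, rfl⟩
  obtain ⟨R, hR'⟩ : ∃ R : F, R = W.a₂ ^ 3 - W.a₁ * W.a₂ * W.a₃ + W.a₃ ^ 2 := ⟨_, rfl⟩
  rw [← hc, ← hR'] at hR ⊢
  -- `C ≠ 0`: else `a₃ = a₁a₂`, `R = a₂³` and the relation reads `a₂⁹ = 0`
  have hc0 : c ≠ 0 := by
    intro h0
    have hRa : R = W.a₂ ^ 3 := by rw [hR']; linear_combination (-W.a₃) * hc + W.a₃ * h0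
    rw [h0, hRa] at hR
    have h' : (W.a₂ ^ 3) ^ 3 = 0 := by linear_combination hR
    exact h2 ((pow_eq_zero_iff (by norm_num : (3 : ℕ) ≠ 0)).1
      ((pow_eq_zero_iff (by norm_num : (3 : ℕ) ≠ 0)).1 h'))
  -- `R ≠ 0`: else the relation reads `a₃C⁵ = 0`
  have hR0 : R ≠ 0 := by
    intro h0
    rw [h0] at hR
    have : W.a₃ * c ^ 5 = 0 := by linear_combination hR
    rcases mul_eq_zero.1 this with h | h
    · exact h3 h
    · exact hc0 ((pow_eq_zero_iff (by norm_num : (5 : ℕ) ≠ 0)).1 h)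
  obtain ⟨f, hf⟩ : ∃ f : F, f = -c ^ 2 / R := ⟨_, rfl⟩
  obtain ⟨u, hu⟩ : ∃ u : F, u = W.a₃ / W.a₂ := ⟨_, rfl⟩
  rw [← hf, ← hu]
  have hf0 : f ≠ 0 := hf ▸ div_ne_zero (neg_ne_zero.2 (pow_ne_zero 2 hc0)) hR0
  have hfR : f * R = -c ^ 2 := by rw [hf, div_mul_cancel₀ _ hR0]
  -- the key consequence of the relation: `a₃ f²(f - 1) = C` (i.e. `c = f²(f-1)`)
  have hcf : W.a₃ * (f ^ 2 * (f - 1)) = c := by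
    have e : (W.a₃ * (f ^ 2 * (f - 1)) - c) * R ^ 3 = 0 := by
      linear_combination (W.a₃ * R ^ 2 * f ^ 2 + W.a₃ * (R + c ^ 2) * (c ^ 2 - R * f)) * hfR +
        (-c) * hR
    exact sub_eq_zero.1 ((mul_eq_zero.1 e).resolve_right (pow_ne_zero 3 hR0))
  have hf1 : f - 1 ≠ 0 := by
    intro h1
    rw [h1, mul_zero, mul_zero] at hcf
    exact hc0 hcf.symm
  -- `a₂³ = -a₃² f²(f-1)(f²-f+1)` (i.e. `b = f²(f-1)(f²-f+1)`)
  have I3 : W.a₂ ^ 3 = -(W.a₃ ^ 2 * (f ^ 2 * (f - 1) * (f ^ 2 - f + 1))) := by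
    have e : f * W.a₂ ^ 3 = f * -(W.a₃ ^ 2 * (f ^ 2 * (f - 1) * (f ^ 2 - f + 1))) := by
      linear_combination (W.a₃ * f ^ 3 - W.a₃ * f ^ 2 + W.a₃ * f + c) * hcf + hfR +
        W.a₃ * f * hc - f * hR'
    exact mul_left_cancel₀ hf0 e
  have hq : f ^ 2 - f + 1 ≠ 0 := by
    intro h0
    rw [h0, mul_zero, mul_zero, neg_zero] at I3
    exact h2 ((pow_eq_zero_iff (by norm_num : (3 : ℕ) ≠ 0)).1 I3)
  have hu0 : u ≠ 0 := hu ▸ div_ne_zero h3 h2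
  refine ⟨hc0, hR0, hf0, hf1, hq, ?_, ?_, ?_⟩
  · rw [hu, div_mul_eq_mul_div, eq_div_iff h2]
    linear_combination hcf + hc
  · rw [hu, div_pow, ← neg_div, div_mul_eq_mul_div, eq_div_iff (pow_ne_zero 2 h2)]
    linear_combination I3
  · rw [hu, div_pow, ← neg_div, div_mul_eq_mul_div, eq_div_iff (pow_ne_zero 3 h2)]
    linear_combination W.a₃ * I3

/-- **The `X₀(9)`-side of the normal form.** On `[a₁, a₂, a₃, 0, 0]` elliptic with `a₂a₃ ≠ 0`
and the `X₁(9)` relation, with `f = -C²/R` Kubert's parameter: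
`Δ = u¹² f⁹(f-1)⁹(f²-f+1)³(f³-6f²+3f+1)` and
`c₄ = u⁴ (f³-3f²+1)(f⁹-9f⁸+27f⁷-48f⁶+54f⁵-45f⁴+27f³-9f²+1)`, so `f³ - 6f² + 3f + 1 ≠ 0` and
`j · f⁹(f-1)⁹(f²-f+1)³(f³-6f²+3f+1) = (f³-3f²+1)³ (f⁹-9f⁸+27f⁷-48f⁶+54f⁵-45f⁴+27f³-9f²+1)³`
(the `j`-invariant of Kubert's `E(b, c)` over `X₁(9)`). [folklore] -/
theorem j_mul_tateNine_normal [W.IsElliptic] (h4 : W.a₄ = 0) (h6 : W.a₆ = 0) (h2 : W.a₂ ≠ 0)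
    (h3 : W.a₃ ≠ 0)
    (hR : (W.a₂ ^ 3 - W.a₁ * W.a₂ * W.a₃ + W.a₃ ^ 2) ^ 3 +
        W.a₃ * (W.a₃ - W.a₁ * W.a₂) ^ 3 *
          ((W.a₃ - W.a₁ * W.a₂) ^ 2 + (W.a₂ ^ 3 - W.a₁ * W.a₂ * W.a₃ + W.a₃ ^ 2)) = 0) :
    (-(W.a₃ - W.a₁ * W.a₂) ^ 2 / (W.a₂ ^ 3 - W.a₁ * W.a₂ * W.a₃ + W.a₃ ^ 2)) ^ 3 -
          6 * (-(W.a₃ - W.a₁ * W.a₂) ^ 2 / (W.a₂ ^ 3 - W.a₁ * W.a₂ * W.a₃ + W.a₃ ^ 2)) ^ 2 +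
          3 * (-(W.a₃ - W.a₁ * W.a₂) ^ 2 / (W.a₂ ^ 3 - W.a₁ * W.a₂ * W.a₃ + W.a₃ ^ 2)) + 1 ≠ 0 ∧
      W.j * ((-(W.a₃ - W.a₁ * W.a₂) ^ 2 / (W.a₂ ^ 3 - W.a₁ * W.a₂ * W.a₃ + W.a₃ ^ 2)) ^ 9 *
          (-(W.a₃ - W.a₁ * W.a₂) ^ 2 / (W.a₂ ^ 3 - W.a₁ * W.a₂ * W.a₃ + W.a₃ ^ 2) - 1) ^ 9 *
          ((-(W.a₃ - W.a₁ * W.a₂) ^ 2 / (W.a₂ ^ 3 - W.a₁ * W.a₂ * W.a₃ + W.a₃ ^ 2)) ^ 2 -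
            -(W.a₃ - W.a₁ * W.a₂) ^ 2 / (W.a₂ ^ 3 - W.a₁ * W.a₂ * W.a₃ + W.a₃ ^ 2) + 1) ^ 3 *
          ((-(W.a₃ - W.a₁ * W.a₂) ^ 2 / (W.a₂ ^ 3 - W.a₁ * W.a₂ * W.a₃ + W.a₃ ^ 2)) ^ 3 -
            6 * (-(W.a₃ - W.a₁ * W.a₂) ^ 2 / (W.a₂ ^ 3 - W.a₁ * W.a₂ * W.a₃ + W.a₃ ^ 2)) ^ 2 +
            3 * (-(W.a₃ - W.a₁ * W.a₂) ^ 2 / (W.a₂ ^ 3 - W.a₁ * W.a₂ * W.a₃ + W.a₃ ^ 2)) + 1)) =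
        ((-(W.a₃ - W.a₁ * W.a₂) ^ 2 / (W.a₂ ^ 3 - W.a₁ * W.a₂ * W.a₃ + W.a₃ ^ 2)) ^ 3 -
            3 * (-(W.a₃ - W.a₁ * W.a₂) ^ 2 / (W.a₂ ^ 3 - W.a₁ * W.a₂ * W.a₃ + W.a₃ ^ 2)) ^ 2 +
            1) ^ 3 *
          ((-(W.a₃ - W.a₁ * W.a₂) ^ 2 / (W.a₂ ^ 3 - W.a₁ * W.a₂ * W.a₃ + W.a₃ ^ 2)) ^ 9 -
            9 * (-(W.a₃ - W.a₁ * W.a₂) ^ 2 / (W.a₂ ^ 3 - W.a₁ * W.a₂ * W.a₃ + W.a₃ ^ 2)) ^ 8 +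
            27 * (-(W.a₃ - W.a₁ * W.a₂) ^ 2 / (W.a₂ ^ 3 - W.a₁ * W.a₂ * W.a₃ + W.a₃ ^ 2)) ^ 7 -
            48 * (-(W.a₃ - W.a₁ * W.a₂) ^ 2 / (W.a₂ ^ 3 - W.a₁ * W.a₂ * W.a₃ + W.a₃ ^ 2)) ^ 6 +
            54 * (-(W.a₃ - W.a₁ * W.a₂) ^ 2 / (W.a₂ ^ 3 - W.a₁ * W.a₂ * W.a₃ + W.a₃ ^ 2)) ^ 5 -
            45 * (-(W.a₃ - W.a₁ * W.a₂) ^ 2 / (W.a₂ ^ 3 - W.a₁ * W.a₂ * W.a₃ + W.a₃ ^ 2)) ^ 4 +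
            27 * (-(W.a₃ - W.a₁ * W.a₂) ^ 2 / (W.a₂ ^ 3 - W.a₁ * W.a₂ * W.a₃ + W.a₃ ^ 2)) ^ 3 -
            9 * (-(W.a₃ - W.a₁ * W.a₂) ^ 2 / (W.a₂ ^ 3 - W.a₁ * W.a₂ * W.a₃ + W.a₃ ^ 2)) ^ 2 +
            1) ^ 3 := by
  obtain ⟨-, -, hf0, hf1, hq, ha₁, ha₂, ha₃⟩ := tate_parametrisation_nine h2 h3 hR
  obtain ⟨u, hu⟩ : ∃ u : F, u = W.a₃ / W.a₂ := ⟨_, rfl⟩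
  obtain ⟨f, hf⟩ : ∃ f : F,
      f = -(W.a₃ - W.a₁ * W.a₂) ^ 2 / (W.a₂ ^ 3 - W.a₁ * W.a₂ * W.a₃ + W.a₃ ^ 2) := ⟨_, rfl⟩
  rw [← hu, ← hf] at ha₁ ha₂ ha₃
  rw [← hf] at hf0 hf1 hq ⊢
  have hu0 : u ≠ 0 := hu ▸ div_ne_zero h3 h2
  have hΔ : W.Δ = u ^ 12 *
      (f ^ 9 * (f - 1) ^ 9 * (f ^ 2 - f + 1) ^ 3 * (f ^ 3 - 6 * f ^ 2 + 3 * f + 1)) := by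
    simp only [WeierstrassCurve.Δ, WeierstrassCurve.b₂, WeierstrassCurve.b₄, WeierstrassCurve.b₆,
      WeierstrassCurve.b₈, h4, h6]
    rw [ha₁, ha₂, ha₃]
    ring
  have hΔ0 : W.Δ ≠ 0 := W.isUnit_Δ.ne_zero
  rw [hΔ] at hΔ0
  have hD : f ^ 3 - 6 * f ^ 2 + 3 * f + 1 ≠ 0 := fun h => hΔ0 (by rw [h]; ring)
  refine ⟨hD, ?_⟩
  have hc₄ : W.c₄ = u ^ 4 * ((f ^ 3 - 3 * f ^ 2 + 1) *
      (f ^ 9 - 9 * f ^ 8 + 27 * f ^ 7 - 48 * f ^ 6 + 54 * f ^ 5 - 45 * f ^ 4 + 27 * f ^ 3 -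
        9 * f ^ 2 + 1)) := by
    simp only [WeierstrassCurve.c₄, WeierstrassCurve.b₂, WeierstrassCurve.b₄, h4]
    rw [ha₁, ha₂, ha₃]
    ring
  rw [WeierstrassCurve.j, Units.val_inv_eq_inv_val, WeierstrassCurve.coe_Δ', hΔ, hc₄]
  have hX : f ^ 9 * (f - 1) ^ 9 * (f ^ 2 - f + 1) ^ 3 * (f ^ 3 - 6 * f ^ 2 + 3 * f + 1) ≠ 0 :=
    mul_ne_zero (mul_ne_zero (mul_ne_zero (pow_ne_zero 9 hf0) (pow_ne_zero 9 hf1))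
      (pow_ne_zero 3 hq)) hD
  generalize f ^ 9 * (f - 1) ^ 9 * (f ^ 2 - f + 1) ^ 3 * (f ^ 3 - 6 * f ^ 2 + 3 * f + 1) = X
    at hX ⊢
  field_simp

/-- **The deck transformation `P ↦ 2P` of `X₁(9) → X₀(9)` in Kubert's coordinate.** On
`[a₁, a₂, a₃, 0, 0]` with `a₂a₃ ≠ 0` and the `X₁(9)` relation, Kubert's parameter at
`Q = 2P₀ = (-a₂, a₁a₂ - a₃)` is `f(Q) = (f - 1)/f`, `f = f(P₀)` (a Möbius transformation of
order `3`: `f ↦ 1 - 1/f ↦ -1/(f - 1) ↦ f`; `(ℤ/9)ˣ/±1` is generated by `2`). [folklore] -/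
theorem tateNine_double_normal (h4 : W.a₄ = 0) (h2 : W.a₂ ≠ 0) (h3 : W.a₃ ≠ 0)
    (hR : (W.a₂ ^ 3 - W.a₁ * W.a₂ * W.a₃ + W.a₃ ^ 2) ^ 3 +
        W.a₃ * (W.a₃ - W.a₁ * W.a₂) ^ 3 *
          ((W.a₃ - W.a₁ * W.a₂) ^ 2 + (W.a₂ ^ 3 - W.a₁ * W.a₂ * W.a₃ + W.a₃ ^ 2)) = 0) :
    W.tateNine (-W.a₂) (W.a₁ * W.a₂ - W.a₃) =
      (-(W.a₃ - W.a₁ * W.a₂) ^ 2 / (W.a₂ ^ 3 - W.a₁ * W.a₂ * W.a₃ + W.a₃ ^ 2) - 1) /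
        (-(W.a₃ - W.a₁ * W.a₂) ^ 2 / (W.a₂ ^ 3 - W.a₁ * W.a₂ * W.a₃ + W.a₃ ^ 2)) := by
  obtain ⟨hc0, -, hf0, hf1, hq, ha₁, ha₂, ha₃⟩ := tate_parametrisation_nine h2 h3 hR
  obtain ⟨u, hu⟩ : ∃ u : F, u = W.a₃ / W.a₂ := ⟨_, rfl⟩
  obtain ⟨f, hf⟩ : ∃ f : F,
      f = -(W.a₃ - W.a₁ * W.a₂) ^ 2 / (W.a₂ ^ 3 - W.a₁ * W.a₂ * W.a₃ + W.a₃ ^ 2) := ⟨_, rfl⟩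
  rw [← hu, ← hf] at ha₁ ha₂ ha₃
  rw [← hf] at hf0 hf1 hq ⊢
  have hu0 : u ≠ 0 := hu ▸ div_ne_zero h3 h2
  have hD : W.a₁ * W.a₂ - W.a₃ ≠ 0 := fun h => hc0 (by linear_combination -h)
  have hnegY : W.toAffine.negY (-W.a₂) (W.a₁ * W.a₂ - W.a₃) = 0 := by
    simp only [Affine.negY]; ring
  have hyQ : W.a₁ * W.a₂ - W.a₃ ≠ W.toAffine.negY (-W.a₂) (W.a₁ * W.a₂ - W.a₃) := by
    rwa [hnegY]
  have hL : W.toAffine.slope (-W.a₂) (-W.a₂) (W.a₁ * W.a₂ - W.a₃) (W.a₁ * W.a₂ - W.a₃) =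
      u * (f * (f - 1) * (f + 1)) := by
    rw [Affine.slope_of_Y_ne rfl hyQ, hnegY, sub_zero, div_eq_iff hD]
    simp only [h4, add_zero]
    rw [ha₁, ha₂, ha₃]
    ring
  have hA₁ : W.tgA₁ (-W.a₂) (W.a₁ * W.a₂ - W.a₃) = u * (f ^ 3 + f ^ 2 - 2 * f + 1) := by
    rw [tgA₁, hL, ha₁]
    ring
  have hA₂ : W.tgA₂ (-W.a₂) (W.a₁ * W.a₂ - W.a₃) = u ^ 2 * (f * (f - 1) ^ 2 * (f ^ 2 - f + 1)) := by
    rw [tgA₂, hL, ha₁, ha₂]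
    ring
  have hA₃ : W.tgA₃ (-W.a₂) (W.a₁ * W.a₂ - W.a₃) = u ^ 3 * (f ^ 4 * (f - 1) ^ 2 * (f ^ 2 - f + 1)) := by
    rw [tgA₃, hnegY, sub_zero, ha₁, ha₂, ha₃]
    ring
  rw [tateNine, hA₁, hA₂, hA₃]
  have hden : (u ^ 2 * (f * (f - 1) ^ 2 * (f ^ 2 - f + 1))) ^ 3 -
      u * (f ^ 3 + f ^ 2 - 2 * f + 1) * (u ^ 2 * (f * (f - 1) ^ 2 * (f ^ 2 - f + 1))) *
          (u ^ 3 * (f ^ 4 * (f - 1) ^ 2 * (f ^ 2 - f + 1))) +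
        (u ^ 3 * (f ^ 4 * (f - 1) ^ 2 * (f ^ 2 - f + 1))) ^ 2 =
      -(u ^ 6 * f ^ 3 * (f - 1) ^ 7 * (f ^ 2 - f + 1) ^ 2) := by
    ring
  rw [hden, div_eq_div_iff (neg_ne_zero.2 (mul_ne_zero (mul_ne_zero (mul_ne_zero
    (pow_ne_zero 6 hu0) (pow_ne_zero 3 hf0)) (pow_ne_zero 7 hf1)) (pow_ne_zero 2 hq))) hf0]
  ring

end Family

/-! ### §4. At a point of order `9`: `f ≠ 0, 1`, `f(2P) = (f(P) - 1)/f(P)`, and `j` -/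

section PointLevel

variable {V : WeierstrassCurve F}

/-- **Kubert's coordinate at a point of order `9`.** Let `P = (x₀, y₀)` be a point of order `9`
on `V` (`9P = O`, `3P ≠ O`) and `2P = (x₁, y₁)`. Then `f = f(P)` satisfies `f ≠ 0`, `f ≠ 1`,
`f² - f + 1 ≠ 0`, the deck-transformation law `f(2P) = (f - 1)/f`, `f³ - 6f² + 3f + 1 ≠ 0` (`V`
elliptic) and
`j(V) f⁹(f-1)⁹(f²-f+1)³(f³-6f²+3f+1) = (f³-3f²+1)³(f⁹-9f⁸+27f⁷-48f⁶+54f⁵-45f⁴+27f³-9f²+1)³`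
(normalise at `P` by `(1, x₀, λ_P, y₀)` and use §3). [folklore] -/
theorem tateNine_of_order_nine [V.IsElliptic] {x₀ y₀ : F} {h : V.toAffine.Nonsingular x₀ y₀}
    (h9 : (9 : ℕ) • (Affine.Point.some _ _ h : V.toAffine.Point) = 0)
    (h3 : (3 : ℕ) • (Affine.Point.some _ _ h : V.toAffine.Point) ≠ 0)
    {x₁ y₁ : F} {h₁ : V.toAffine.Nonsingular x₁ y₁}
    (hQ : (Affine.Point.some _ _ h : V.toAffine.Point) + .some _ _ h = .some _ _ h₁) :
    V.tateNine x₀ y₀ ≠ 0 ∧ V.tateNine x₀ y₀ - 1 ≠ 0 ∧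
      V.tateNine x₀ y₀ ^ 2 - V.tateNine x₀ y₀ + 1 ≠ 0 ∧
      V.tateNine x₁ y₁ = (V.tateNine x₀ y₀ - 1) / V.tateNine x₀ y₀ ∧
      V.tateNine x₀ y₀ ^ 3 - 6 * V.tateNine x₀ y₀ ^ 2 + 3 * V.tateNine x₀ y₀ + 1 ≠ 0 ∧
      V.j * (V.tateNine x₀ y₀ ^ 9 * (V.tateNine x₀ y₀ - 1) ^ 9 *
          (V.tateNine x₀ y₀ ^ 2 - V.tateNine x₀ y₀ + 1) ^ 3 *
          (V.tateNine x₀ y₀ ^ 3 - 6 * V.tateNine x₀ y₀ ^ 2 + 3 * V.tateNine x₀ y₀ + 1)) =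
        (V.tateNine x₀ y₀ ^ 3 - 3 * V.tateNine x₀ y₀ ^ 2 + 1) ^ 3 *
          (V.tateNine x₀ y₀ ^ 9 - 9 * V.tateNine x₀ y₀ ^ 8 + 27 * V.tateNine x₀ y₀ ^ 7 -
            48 * V.tateNine x₀ y₀ ^ 6 + 54 * V.tateNine x₀ y₀ ^ 5 -
            45 * V.tateNine x₀ y₀ ^ 4 + 27 * V.tateNine x₀ y₀ ^ 3 -
            9 * V.tateNine x₀ y₀ ^ 2 + 1) ^ 3 := by
  set P : V.toAffine.Point := .some _ _ h with hPdef
  -- consequences of `9P = O`, `3P ≠ O` in the group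
  have hy : y₀ ≠ V.toAffine.negY x₀ y₀ := by
    intro hyy
    have h2 : P + P = 0 := Affine.Point.add_self_of_Y_eq hyy
    rw [h2] at hQ
    exact Affine.Point.some_ne_zero _ hQ.symm
  have hT9 : (P + (P + P)) + (P + (P + P)) = -(P + (P + P)) := by
    apply eq_neg_of_add_eq_zero_left
    have e : (P + (P + P)) + (P + (P + P)) + (P + (P + P)) = (9 : ℕ) • P := by abel
    rw [e, h9]
  have hT6 : (P + (P + P)) + (P + (P + P)) ≠ 0 := by
    intro h6
    apply h3
    have e : (3 : ℕ) • P = (P + (P + P)) + (P + (P + P)) + (P + (P + P)) -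
        ((P + (P + P)) + (P + (P + P))) := by abel
    have e' : (P + (P + P)) + (P + (P + P)) + (P + (P + P)) = (9 : ℕ) • P := by abel
    rw [e, e', h9, h6, sub_zero]
  have hne : P + P ≠ -P := by
    intro h2
    apply h3
    have e : (3 : ℕ) • P = P + (P + P) := by abel
    rw [e, h2, add_neg_cancel]
  have hy₁ : y₁ ≠ V.toAffine.negY x₁ y₁ := by
    intro hyy
    have h4 : (P + P) + (P + P) = 0 := by rw [hQ]; exact Affine.Point.add_self_of_Y_eq hyy
    apply Affine.Point.some_ne_zero h
    have e : P = (9 : ℕ) • P - ((P + P) + (P + P)) - ((P + P) + (P + P)) := by abel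
    rw [← hPdef, e, h9, h4, sub_zero, sub_zero]
  simp only [hPdef] at hne hT6 hT9 hQ
  -- normalise at `P`
  have hV' := variableChange_tangent_eq (W := V) h.1 hy
  obtain ⟨h₀, hP'⟩ := pointEquiv_tangent_some (W := V) h
  have hQ' := VariableChange.pointEquiv_some V
    (⟨1, x₀, V.toAffine.slope x₀ x₀ y₀ y₀, y₀⟩ : VariableChange F) h₁
  have hf₀ := tateNine_toXY (W := V) (⟨1, x₀, V.toAffine.slope x₀ x₀ y₀ y₀, y₀⟩ :
    VariableChange F) rfl h.1 hy
  have hf₁ := tateNine_toXY (W := V) (⟨1, x₀, V.toAffine.slope x₀ x₀ y₀ y₀, y₀⟩ :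
    VariableChange F) rfl h₁.1 hy₁
  have hA₁ : V.tgA₁ x₀ y₀ = ((⟨1, x₀, V.toAffine.slope x₀ x₀ y₀ y₀, y₀⟩ :
      VariableChange F) • V).a₁ := by rw [hV', tgA₁]
  have hA₂ : V.tgA₂ x₀ y₀ = ((⟨1, x₀, V.toAffine.slope x₀ x₀ y₀ y₀, y₀⟩ :
      VariableChange F) • V).a₂ := by rw [hV', tgA₂]
  have hA₃ : V.tgA₃ x₀ y₀ = ((⟨1, x₀, V.toAffine.slope x₀ x₀ y₀ y₀, y₀⟩ :
      VariableChange F) • V).a₃ := by rw [hV', tgA₃]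
  revert h₀ hP' hV' hQ' hf₀ hf₁ hA₁ hA₂ hA₃
  generalize (⟨1, x₀, V.toAffine.slope x₀ x₀ y₀ y₀, y₀⟩ : VariableChange F) = C
  intro hV' h₀ hP' hQ' hf₀ hf₁ hA₁ hA₂ hA₃
  have h4' : (C • V).a₄ = 0 := by rw [hV']
  have h6' : (C • V).a₆ = 0 := by rw [hV']
  have h3' : (C • V).a₃ ≠ 0 := by rw [hV']; exact sub_ne_zero.2 hy
  -- transport the group-law facts to the normal form
  have hne' : VariableChange.pointEquiv V C (.some _ _ h + .some _ _ h) ≠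
      VariableChange.pointEquiv V C (-.some _ _ h) :=
    fun e => hne ((VariableChange.pointEquiv V C).injective e)
  have hT6' : VariableChange.pointEquiv V C
      ((.some _ _ h + (.some _ _ h + .some _ _ h)) + (.some _ _ h + (.some _ _ h + .some _ _ h))) ≠
        0 :=
    fun e => hT6 ((VariableChange.pointEquiv V C).injective
      (e.trans (map_zero (VariableChange.pointEquiv V C)).symm))
  have hT9' := congrArg (VariableChange.pointEquiv V C) hT9
  simp only [map_add, map_neg, hP'] at hne' hT6' hT9'
  obtain ⟨h2', hR'⟩ := tate_relation_of_order_nine h4' h6' h3' hne' hT6' hT9'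
  obtain ⟨hc0, hR0, hf0, hf1, hq, -, -, -⟩ := tate_parametrisation_nine h2' h3' hR'
  -- `f(P)` is Kubert's parameter of the normal form
  have hP'' := hP'
  rw [VariableChange.pointEquiv_some] at hP''
  obtain ⟨hX0, hY0⟩ := (Affine.Point.some.injEq _ _ _ _ _ _).mp hP''
  have hfP : V.tateNine x₀ y₀ =
      -((C • V).a₃ - (C • V).a₁ * (C • V).a₂) ^ 2 /
        ((C • V).a₂ ^ 3 - (C • V).a₁ * (C • V).a₂ * (C • V).a₃ + (C • V).a₃ ^ 2) := by
    rw [← hf₀, hX0, hY0, tateNine_origin h4' h3']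
  -- `f(2P)`: `2P ↦ (0,0) + (0,0) = (-a₂', a₁'a₂' - a₃')`
  have h2P := congrArg (VariableChange.pointEquiv V C) hQ
  rw [map_add, hP', hQ'] at h2P
  obtain ⟨hQ'', h2⟩ := two_smul_zero_zero h4' h6' h3'
  rw [h2] at h2P
  obtain ⟨hX1, hY1⟩ := (Affine.Point.some.injEq _ _ _ _ _ _).mp h2P
  have hfQ : V.tateNine x₁ y₁ = (V.tateNine x₀ y₀ - 1) / V.tateNine x₀ y₀ := by
    rw [← hf₁, ← hX1, ← hY1, tateNine_double_normal h4' h2' h3' hR', hfP]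
  rw [hfP] at hfQ ⊢
  obtain ⟨hD, hj⟩ := j_mul_tateNine_normal (W := C • V) h4' h6' h2' h3' hR'
  rw [variableChange_j] at hj
  exact ⟨hf0, hf1, hq, hfQ, hD, hj⟩

end PointLevel

/-! ### §5. The Hauptmodul `η = (f³ - 6f² + 3f + 1)/(f(f - 1))` of `X₀(9)` -/

section Hauptmodul

/-- `η(f) = (f³ - 6f² + 3f + 1)/(f(f-1)) = f + f' + f'' - 6` (`f' = (f-1)/f`, `f'' = -1/(f-1)`)
is invariant under the deck transformation `f ↦ (f - 1)/f`. [folklore] -/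
theorem hauptmodul_nine_eq_of_double {z : F} (hz0 : z ≠ 0) (hz1 : z - 1 ≠ 0) :
    (((z - 1) / z) ^ 3 - 6 * ((z - 1) / z) ^ 2 + 3 * ((z - 1) / z) + 1) /
        ((z - 1) / z * ((z - 1) / z - 1)) =
      (z ^ 3 - 6 * z ^ 2 + 3 * z + 1) / (z * (z - 1)) := by
  have h1 : (z - 1) / z * ((z - 1) / z - 1) = -(z - 1) / z ^ 2 := by
    field_simp
    ring
  rw [h1, div_eq_div_iff (div_ne_zero (neg_ne_zero.2 hz1) (pow_ne_zero 2 hz0))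
    (mul_ne_zero hz0 hz1)]
  field_simp
  ring

/-- **From Kubert's parameter to the Hauptmodul of `X₀(9)`.** If `f ≠ 0, 1`, `f² - f + 1 ≠ 0`,
`f³ - 6f² + 3f + 1 ≠ 0` and `j f⁹(f-1)⁹(f²-f+1)³(f³-6f²+3f+1) = (f³-3f²+1)³(f⁹-…+1)³`, then
`η := (f³ - 6f² + 3f + 1)/(f(f-1))` satisfies `η(η² + 9η + 27) ≠ 0` and
`j · η(η² + 9η + 27) = (η + 3)³(η³ + 9η² + 27η + 3)³` — the rational modular equation of level `9`
(`η + 3 = (f³-3f²+1)/(f(f-1))`, `η² + 9η + 27 = (f²-f+1)³/(f²(f-1)²)`,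
`η³ + 9η² + 27η + 3 = (f⁹-9f⁸+…+1)/(f³(f-1)³)`). [cite: Maier2006, Table 4 (N = 9)] -/
theorem j_mul_hauptmodul_nine {j f : F} (hf0 : f ≠ 0) (hf1 : f - 1 ≠ 0) (hq : f ^ 2 - f + 1 ≠ 0)
    (hD : f ^ 3 - 6 * f ^ 2 + 3 * f + 1 ≠ 0)
    (hj : j * (f ^ 9 * (f - 1) ^ 9 * (f ^ 2 - f + 1) ^ 3 * (f ^ 3 - 6 * f ^ 2 + 3 * f + 1)) =
      (f ^ 3 - 3 * f ^ 2 + 1) ^ 3 *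
        (f ^ 9 - 9 * f ^ 8 + 27 * f ^ 7 - 48 * f ^ 6 + 54 * f ^ 5 - 45 * f ^ 4 + 27 * f ^ 3 -
          9 * f ^ 2 + 1) ^ 3) :
    (f ^ 3 - 6 * f ^ 2 + 3 * f + 1) / (f * (f - 1)) *
          (((f ^ 3 - 6 * f ^ 2 + 3 * f + 1) / (f * (f - 1))) ^ 2 +
            9 * ((f ^ 3 - 6 * f ^ 2 + 3 * f + 1) / (f * (f - 1))) + 27) ≠ 0 ∧
      j * ((f ^ 3 - 6 * f ^ 2 + 3 * f + 1) / (f * (f - 1)) *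
          (((f ^ 3 - 6 * f ^ 2 + 3 * f + 1) / (f * (f - 1))) ^ 2 +
            9 * ((f ^ 3 - 6 * f ^ 2 + 3 * f + 1) / (f * (f - 1))) + 27)) =
        ((f ^ 3 - 6 * f ^ 2 + 3 * f + 1) / (f * (f - 1)) + 3) ^ 3 *
          (((f ^ 3 - 6 * f ^ 2 + 3 * f + 1) / (f * (f - 1))) ^ 3 +
            9 * ((f ^ 3 - 6 * f ^ 2 + 3 * f + 1) / (f * (f - 1))) ^ 2 +
            27 * ((f ^ 3 - 6 * f ^ 2 + 3 * f + 1) / (f * (f - 1))) + 3) ^ 3 := by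
  have hff : f * (f - 1) ≠ 0 := mul_ne_zero hf0 hf1
  have hX : f ^ 9 * (f - 1) ^ 9 * (f ^ 2 - f + 1) ^ 3 * (f ^ 3 - 6 * f ^ 2 + 3 * f + 1) ≠ 0 :=
    mul_ne_zero (mul_ne_zero (mul_ne_zero (pow_ne_zero 9 hf0) (pow_ne_zero 9 hf1))
      (pow_ne_zero 3 hq)) hD
  have hj' : j = (f ^ 3 - 3 * f ^ 2 + 1) ^ 3 *
      (f ^ 9 - 9 * f ^ 8 + 27 * f ^ 7 - 48 * f ^ 6 + 54 * f ^ 5 - 45 * f ^ 4 + 27 * f ^ 3 -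
        9 * f ^ 2 + 1) ^ 3 /
      (f ^ 9 * (f - 1) ^ 9 * (f ^ 2 - f + 1) ^ 3 * (f ^ 3 - 6 * f ^ 2 + 3 * f + 1)) := by
    rw [eq_div_iff hX]
    exact hj
  have hH : (f ^ 3 - 6 * f ^ 2 + 3 * f + 1) / (f * (f - 1)) *
      (((f ^ 3 - 6 * f ^ 2 + 3 * f + 1) / (f * (f - 1))) ^ 2 +
        9 * ((f ^ 3 - 6 * f ^ 2 + 3 * f + 1) / (f * (f - 1))) + 27) =
      (f ^ 2 - f + 1) ^ 3 * (f ^ 3 - 6 * f ^ 2 + 3 * f + 1) / (f ^ 3 * (f - 1) ^ 3) := by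
    rw [eq_div_iff (mul_ne_zero (pow_ne_zero 3 hf0) (pow_ne_zero 3 hf1))]
    field_simp
    ring
  have hH2 : (f ^ 3 - 6 * f ^ 2 + 3 * f + 1) / (f * (f - 1)) + 3 =
      (f ^ 3 - 3 * f ^ 2 + 1) / (f * (f - 1)) := by
    rw [div_add' _ _ _ hff]
    congr 1
    ring
  have hH3 : ((f ^ 3 - 6 * f ^ 2 + 3 * f + 1) / (f * (f - 1))) ^ 3 +
      9 * ((f ^ 3 - 6 * f ^ 2 + 3 * f + 1) / (f * (f - 1))) ^ 2 +
        27 * ((f ^ 3 - 6 * f ^ 2 + 3 * f + 1) / (f * (f - 1))) + 3 =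
      (f ^ 9 - 9 * f ^ 8 + 27 * f ^ 7 - 48 * f ^ 6 + 54 * f ^ 5 - 45 * f ^ 4 + 27 * f ^ 3 -
        9 * f ^ 2 + 1) / (f ^ 3 * (f - 1) ^ 3) := by
    rw [eq_div_iff (mul_ne_zero (pow_ne_zero 3 hf0) (pow_ne_zero 3 hf1))]
    field_simp
    ring
  refine ⟨?_, ?_⟩
  · rw [hH]
    exact div_ne_zero (mul_ne_zero (pow_ne_zero 3 hq) hD)
      (mul_ne_zero (pow_ne_zero 3 hf0) (pow_ne_zero 3 hf1))
  · rw [hj', hH, hH2, hH3, div_pow, div_pow, div_mul_div_comm, div_mul_div_comm,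
      div_eq_div_iff (mul_ne_zero hX (mul_ne_zero (pow_ne_zero 3 hf0) (pow_ne_zero 3 hf1)))
        (mul_ne_zero (pow_ne_zero 3 hff) (pow_ne_zero 3 (mul_ne_zero (pow_ne_zero 3 hf0)
          (pow_ne_zero 3 hf1))))]
    ring

end Hauptmodul

/-! ### §6. Galois descent: a stable cyclic subgroup of order `9` gives a point of `X₀(9)` -/

section Descent

/-- **A Galois-stable cyclic subgroup of order `9` gives an `F`-point of `X₀(9)`** (Klein–Fricke,
level `9`). Let `W/F` be an elliptic curve, `L/F` Galois, and `P ∈ W(L)` a point of order `9`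
whose cyclic subgroup `ℤP` is `Gal(L/F)`-stable. Then there is `η ∈ F` with
`η(η² + 9η + 27) ≠ 0` and `j(W) · η(η² + 9η + 27) = (η + 3)³(η³ + 9η² + 27η + 3)³`, the rational
modular equation of level `9` (`j = (t₉+3)³(t₉³+9t₉²+27t₉+3)³/(t₉(t₉²+9t₉+27))`,
[cite: Maier2006, Table 4 (N = 9)]). Proof: `η = (f³-6f²+3f+1)/(f(f-1))` for Kubert's
coordinate `f = f(P)` (§4–5); `σ` moves `f(P)` to `f(σP) ∈ {f(±P), f(±2P), f(±4P)} =
{f, (f-1)/f, -1/(f-1)}`, on which `η` is constant, so `η ∈ F`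
(`InfiniteGalois.mem_range_algebraMap_iff_fixed`). [folklore] -/
theorem exists_hauptmodul_nine_of_torsion [IsGalois F L] [W.IsElliptic]
    {P : (W.baseChange L).toAffine.Point} (h9 : addOrderOf P = 9)
    (hσ : ∀ σ : L ≃ₐ[F] L, σ • P ∈ AddSubgroup.zmultiples P) :
    ∃ η : F, η * (η ^ 2 + 9 * η + 27) ≠ 0 ∧
      W.j * (η * (η ^ 2 + 9 * η + 27)) = (η + 3) ^ 3 * (η ^ 3 + 9 * η ^ 2 + 27 * η + 3) ^ 3 := by
  haveI : (W.baseChange L).IsElliptic := by rw [baseChange]; infer_instance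
  -- order bookkeeping
  have h9P : (9 : ℕ) • P = 0 := h9 ▸ addOrderOf_nsmul_eq_zero P
  have hmul : ∀ k : ℕ, k • P = 0 → 9 ∣ k := fun k hk => h9 ▸ addOrderOf_dvd_of_nsmul_eq_zero hk
  have hP0 : P ≠ 0 := fun e => by have := hmul 1 (by rw [one_nsmul, e]); omega
  have h2P : (2 : ℕ) • P ≠ 0 := fun e => by have := hmul 2 e; omega
  have h3P : (3 : ℕ) • P ≠ 0 := fun e => by have := hmul 3 e; omega
  have h4P : (4 : ℕ) • P ≠ 0 := fun e => by have := hmul 4 e; omega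
  have h8P : (8 : ℕ) • P ≠ 0 := fun e => by have := hmul 8 e; omega
  rcases P with _ | ⟨x₀, y₀, h⟩
  · exact absurd rfl hP0
  -- `2P = (x₁, y₁)` and `4P = (x₂, y₂)` are affine
  obtain ⟨x₁, y₁, h₁, hQ⟩ : ∃ x₁ y₁ h₁, (Affine.Point.some _ _ h : (W.baseChange
      L).toAffine.Point) + .some _ _ h = .some x₁ y₁ h₁ := by
    rcases hPP : (Affine.Point.some _ _ h : (W.baseChange L).toAffine.Point) + .some _ _ h with
        _ | ⟨x₁, y₁, h₁⟩
    · exact absurd (by rw [two_nsmul, hPP, ← Affine.Point.zero_def]) h2P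
    · exact ⟨x₁, y₁, h₁, hPP⟩
  have e4 : (4 : ℕ) • (Affine.Point.some _ _ h : (W.baseChange L).toAffine.Point) =
      (.some _ _ h + .some _ _ h) + (.some _ _ h + .some _ _ h) := by
    abel
  obtain ⟨x₂, y₂, h₂, hR⟩ : ∃ x₂ y₂ h₂, (Affine.Point.some _ _ h₁ : (W.baseChange
      L).toAffine.Point) + .some _ _ h₁ = .some x₂ y₂ h₂ := by
    rcases hQQ : (Affine.Point.some _ _ h₁ : (W.baseChange L).toAffine.Point) + .some _ _ h₁ with
        _ | ⟨x₂, y₂, h₂⟩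
    · exact absurd (by rw [e4, hQ, hQQ, ← Affine.Point.zero_def]) h4P
    · exact ⟨x₂, y₂, h₂, hQQ⟩
  -- `P ≠ -P`, `2P ≠ -2P`, `4P ≠ -4P`
  have hy : y₀ ≠ (W.baseChange L).toAffine.negY x₀ y₀ := fun hyy =>
    h2P (by rw [two_nsmul]; exact Affine.Point.add_self_of_Y_eq hyy)
  have hy₁ : y₁ ≠ (W.baseChange L).toAffine.negY x₁ y₁ := fun hyy =>
    h4P (by rw [e4, hQ]; exact Affine.Point.add_self_of_Y_eq hyy)
  have e8 : (8 : ℕ) • (Affine.Point.some _ _ h : (W.baseChange L).toAffine.Point) =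
      ((.some _ _ h + .some _ _ h) + (.some _ _ h + .some _ _ h)) +
        ((.some _ _ h + .some _ _ h) + (.some _ _ h + .some _ _ h)) := by
    abel
  have hy₂ : y₂ ≠ (W.baseChange L).toAffine.negY x₂ y₂ := fun hyy =>
    h8P (by rw [e8, hQ, hR]; exact Affine.Point.add_self_of_Y_eq hyy)
  -- Kubert's coordinate at `P` (`f₀`), `2P` (`f₁ = (f₀-1)/f₀`) and `4P` (`f₂ = (f₁-1)/f₁`)
  have h9Q : (9 : ℕ) • (Affine.Point.some _ _ h₁ : (W.baseChange L).toAffine.Point) = 0 := by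
    rw [← hQ, nsmul_add, h9P, add_zero]
  have h3Q : (3 : ℕ) • (Affine.Point.some _ _ h₁ : (W.baseChange L).toAffine.Point) ≠ 0 := by
    rw [← hQ]
    intro e
    have e' : (6 : ℕ) • (Affine.Point.some _ _ h : (W.baseChange L).toAffine.Point) = 0 := by
      rw [← e]
      abel
    have := hmul 6 e'
    omega
  obtain ⟨hf0, hf1, hq, hfQ, hD, hj⟩ :=
    tateNine_of_order_nine (V := W.baseChange L) h9P h3P hQ
  obtain ⟨hf0', hf1', -, hfR, -, -⟩ :=
    tateNine_of_order_nine (V := W.baseChange L) h9Q h3Q hR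
  -- Galois moves `f(P)` within `{f₀, f₁, f₂}`
  have hT : ∀ σ : L ≃ₐ[F] L,
      σ ((W.baseChange L).tateNine x₀ y₀) = (W.baseChange L).tateNine x₀ y₀ ∨
      σ ((W.baseChange L).tateNine x₀ y₀) = (W.baseChange L).tateNine x₁ y₁ ∨
      σ ((W.baseChange L).tateNine x₀ y₀) = (W.baseChange L).tateNine x₂ y₂ := by
    intro σ
    have key := map_tateNine (W := W) (σ : L →ₐ[F] L) x₀ y₀
    rw [AlgEquiv.coe_toAlgHom] at key
    rw [key]
    -- `σP = mP`, `m = n mod 9 ∈ {0, …, 8}`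
    obtain ⟨n, hn⟩ := AddSubgroup.mem_zmultiples_iff.mp (hσ σ)
    have hmod := mod_addOrderOf_zsmul
      (Affine.Point.some _ _ h : (W.baseChange L).toAffine.Point) n
    rw [h9, hn] at hmod
    push_cast at hmod
    have h0n : 0 ≤ n % 9 := Int.emod_nonneg _ (by norm_num)
    have h9n : n % 9 < 9 := Int.emod_lt_of_pos _ (by norm_num)
    -- coordinates of `σP` from an equation `σP = (x', y')`
    have coords : ∀ {x' y' : L} {h' : (W.baseChange L).toAffine.Nonsingular x' y'},
        σ • (Affine.Point.some _ _ h : (W.baseChange L).toAffine.Point) = .some _ _ h' →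
          σ x₀ = x' ∧ σ y₀ = y' := by
      intro x' y' h' hσP
      change Affine.Point.map (σ : L →ₐ[F] L) (Affine.Point.some _ _ h) = _ at hσP
      rw [Affine.Point.map_some] at hσP
      simpa only [Affine.Point.some.injEq, AlgEquiv.coe_toAlgHom] using hσP
    have e1 := map_nsmul (DistribSMul.toAddMonoidHom _ σ) 3
      (Affine.Point.some _ _ h : (W.baseChange L).toAffine.Point)
    simp only [DistribSMul.toAddMonoidHom_apply] at e1
    generalize n % 9 = m at hmod h0n h9n
    interval_cases m
    · -- `σP = O`: impossible
      rw [zero_zsmul] at hmod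
      exact absurd ((smul_eq_zero_iff_eq σ).mp hmod.symm) (Affine.Point.some_ne_zero h)
    · -- `σP = P`
      rw [one_zsmul] at hmod
      obtain ⟨hx, hy'⟩ := coords hmod.symm
      exact Or.inl (by rw [hx, hy'])
    · -- `σP = 2P`
      rw [two_zsmul, hQ] at hmod
      obtain ⟨hx, hy'⟩ := coords hmod.symm
      exact Or.inr (Or.inl (by rw [hx, hy']))
    · -- `σP = 3P`: then `σ(3P) = 9P = O`, impossible
      rw [ofNat_zsmul] at hmod
      refine (h3P ((smul_eq_zero_iff_eq σ).mp ?_)).elim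
      rw [e1, ← hmod, smul_smul]
      exact h9P
    · -- `σP = 4P`
      rw [ofNat_zsmul, e4, hQ, hR] at hmod
      obtain ⟨hx, hy'⟩ := coords hmod.symm
      exact Or.inr (Or.inr (by rw [hx, hy']))
    · -- `σP = 5P = -4P`
      have e5 : (5 : ℕ) • (Affine.Point.some _ _ h : (W.baseChange L).toAffine.Point) =
          -.some _ _ h₂ := by
        rw [eq_neg_iff_add_eq_zero, ← hR, ← hQ, ← e4, ← add_nsmul]
        exact h9P
      rw [ofNat_zsmul, e5, Affine.Point.neg_some] at hmod
      obtain ⟨hx, hy'⟩ := coords hmod.symm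
      exact Or.inr (Or.inr (by rw [hx, hy', tateNine_negY hy₂]))
    · -- `σP = 6P`: then `σ(3P) = 18P = O`, impossible
      rw [ofNat_zsmul] at hmod
      refine (h3P ((smul_eq_zero_iff_eq σ).mp ?_)).elim
      rw [e1, ← hmod, smul_smul, show (3 * 6 : ℕ) = 9 + 9 from rfl, add_nsmul, h9P, add_zero]
    · -- `σP = 7P = -2P`
      have e7 : (7 : ℕ) • (Affine.Point.some _ _ h : (W.baseChange L).toAffine.Point) =
          -.some _ _ h₁ := by
        rw [eq_neg_iff_add_eq_zero, ← hQ, ← two_nsmul, ← add_nsmul]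
        exact h9P
      rw [ofNat_zsmul, e7, Affine.Point.neg_some] at hmod
      obtain ⟨hx, hy'⟩ := coords hmod.symm
      exact Or.inr (Or.inl (by rw [hx, hy', tateNine_negY hy₁]))
    · -- `σP = 8P = -P`
      have e8' : (8 : ℕ) • (Affine.Point.some _ _ h : (W.baseChange L).toAffine.Point) =
          -.some _ _ h := by
        rw [eq_neg_iff_add_eq_zero, ← succ_nsmul]
        exact h9P
      rw [ofNat_zsmul, e8', Affine.Point.neg_some] at hmod
      obtain ⟨hx, hy'⟩ := coords hmod.symm
      exact Or.inl (by rw [hx, hy', tateNine_negY hy])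
  -- hence `η = (f³ - 6f² + 3f + 1)/(f(f-1))` is Galois invariant
  revert hf0 hf1 hq hfQ hD hj hf0' hf1' hfR hT
  generalize (W.baseChange L).tateNine x₀ y₀ = u
  generalize (W.baseChange L).tateNine x₁ y₁ = v
  generalize (W.baseChange L).tateNine x₂ y₂ = w
  intro hf0 hf1 hq hfQ hD hj hf0' hf1' hfR hT
  have hfix : ∀ σ : L ≃ₐ[F] L,
      σ ((u ^ 3 - 6 * u ^ 2 + 3 * u + 1) / (u * (u - 1))) =
        (u ^ 3 - 6 * u ^ 2 + 3 * u + 1) / (u * (u - 1)) := by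
    intro σ
    simp only [map_div₀, map_mul, map_add, map_sub, map_pow, map_one, map_ofNat]
    rcases hT σ with e | e | e
    · rw [e]
    · rw [e, hfQ]
      exact hauptmodul_nine_eq_of_double hf0 hf1
    · rw [e, hfR, hauptmodul_nine_eq_of_double hf0' hf1', hfQ]
      exact hauptmodul_nine_eq_of_double hf0 hf1
  obtain ⟨g, hg⟩ := (InfiniteGalois.mem_range_algebraMap_iff_fixed _).mpr hfix
  obtain ⟨hH0, hjH⟩ := j_mul_hauptmodul_nine hf0 hf1 hq hD hj
  have hgη : algebraMap F L (g * (g ^ 2 + 9 * g + 27)) =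
      (u ^ 3 - 6 * u ^ 2 + 3 * u + 1) / (u * (u - 1)) *
        (((u ^ 3 - 6 * u ^ 2 + 3 * u + 1) / (u * (u - 1))) ^ 2 +
          9 * ((u ^ 3 - 6 * u ^ 2 + 3 * u + 1) / (u * (u - 1))) + 27) := by
    simp only [map_mul, map_add, map_pow, map_ofNat, hg]
  refine ⟨g, ?_, ?_⟩
  · intro h0
    apply hH0
    rw [← hgη, h0, map_zero]
  · apply (algebraMap F L).injective
    have hjL : algebraMap F L W.j = (W.baseChange L).j := (W.map_j _).symm
    simp only [map_mul, map_add, map_pow, map_ofNat, hjL, hg]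
    exact hjH

/-- **A rational cyclic `9`-isogeny gives a rational point of `X₀(9)`.** Over a field `K` of
characteristic `0`: if the elliptic curve `W/K` admits a `K`-rational isogeny with cyclic kernel
of order `9`, then `j(W) · η(η² + 9η + 27) = (η + 3)³(η³ + 9η² + 27η + 3)³` for some `η ∈ K` with
`η(η² + 9η + 27) ≠ 0` (the kernel is generated by a point `P ∈ W(K̄)` of order `9` with
`Γ_K`-stable `ℤP`; apply `exists_hauptmodul_nine_of_torsion` with `L = K̄`). This is the level-`9`
entry of Fricke's list of rational modular equations [cite: Maier2006, Table 4 (N = 9)] and the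
`X₀(9)`-input of Kenku's determination of the levels `27, 45, 63, 81`. [folklore] -/
theorem Isogeny.exists_hauptmodul_nine_of_isCyclic {K : Type u} [Field K] [CharZero K]
    {W W' : WeierstrassCurve K} [W.IsElliptic] (φ : Isogeny W W') (hφ : φ.IsCyclic)
    (hdeg : φ.degree = 9) :
    ∃ η : K, η * (η ^ 2 + 9 * η + 27) ≠ 0 ∧
      W.j * (η * (η ^ 2 + 9 * η + 27)) = (η + 3) ^ 3 * (η ^ 3 + 9 * η ^ 2 + 27 * η + 3) ^ 3 := by
  haveI : IsGalois K (AlgebraicClosure K) := {}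
  haveI : IsAddCyclic φ.toAddMonoidHom.ker := hφ
  obtain ⟨g, hg⟩ := IsAddCyclic.exists_ofOrder_eq_natCard (α := φ.toAddMonoidHom.ker)
  have hordP : addOrderOf (g : W.geomPoints) = 9 := by
    rw [AddSubgroup.addOrderOf_coe, hg]
    exact hdeg
  have hgen : AddSubgroup.zmultiples (g : W.geomPoints) = φ.toAddMonoidHom.ker := by
    apply AddSubgroup.eq_of_le_of_card_ge (AddSubgroup.zmultiples_le.mpr g.2)
    rw [Nat.card_zmultiples, hordP]
    exact hdeg.le
  have hg0 : φ (g : W.geomPoints) = 0 := (AddMonoidHom.mem_ker).mp g.2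
  have hst : ∀ σ : Field.absoluteGaloisGroup K,
      σ • (g : W.geomPoints) ∈ AddSubgroup.zmultiples (g : W.geomPoints) := fun σ => by
    rw [hgen, AddMonoidHom.mem_ker, Isogeny.coe_toAddMonoidHom, φ.map_smul, hg0, smul_zero]
  exact exists_hauptmodul_nine_of_torsion (W := W) (L := AlgebraicClosure K)
    (P := (g : W.geomPoints)) hordP hst

end Descent

end WeierstrassCurve

end
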